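import Summits.AtomisticToContinuum.Crystallization.Theorems.FrustratedLawDichotomyVacancyField

/-!
# FrustratedLawDichotomy · crux `AperiodicFrustratedLawGap` (stmt-AtomisticToContinuum-27623) — THE VACANCY FLOOR «no deep holes»
# (decomp-a2c, prover hand 1, direct share, generation 5; part 2 of 2)

Part 1 (`FrustratedLawDichotomyVacancyField`) read the Nash clause (e) globally: for a rooted hard-core configuration `μ` whose root
passes the one-particle Nash test and a vacant point `y`, `2·rootEnergy V_LJ μ ≤ Φ_μ(y) + 1/12`, `Φ_μ(y) = Σ_q V_LJ(dist y q)` the field.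
Here this becomes a LAW-LEVEL necessary condition with NO minimality hypothesis.

* §1 the DEEP-HOLE EVENT `K_c = {ν | ∃ n, ν {d_n} = 0 ∧ Φ_ν(d_n) < c}` (`d` the dense sequence of `ℝ³`, `Φ` through its `ℝ≥0∞` parts):
  Giry-measurable (`measurableSet_holeEvent`), and invariant under re-rooting of rooted hard-core configurations
  (`holeEvent_invariant`: the field and vacancy are covariant, `lintegral_field_map_sub` / `map_sub_apply_singleton`, and the
  deep-hole set is open in `y`, part 1's `exists_denseSeq_hole`);
* §2 **`measure_holeEvent_eq_zero_of_nash`** — under clauses (a) (any `δ > 0`), (b), (e) of the crux and the energy floor of item 9229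
  (hypothesis `hU`, as in every file of this line), `P(K_c) = 0` whenever `c + 1/12 < 2e⋆`: on `K_c` every configuration has
  `rootEnergy ≤ (c + 1/12)/2 < e⋆` by part 1, `K_c` is invariant, so the conditioned law `(P K_c)⁻¹ • P|K_c` would be a point-stationary
  hard-core probability law with mean root energy `< e⋆` — against the floor;
* **`ae_vacancyFloor_of_nash`** — THE VACANCY FLOOR: `P`-a.s., at EVERY vacant point `y` (`μ {y} = 0`), `2e⋆ − 1/12 ≤ Φ_μ(y)`;
  `ae_vacancyFloor_tsum_of_nash` — the same with `Φ_μ(y)` as the series `Σ'_{q atom} V_LJ(dist y q)` of the crux's vocabulary.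

Reading for the residual (hand 2's force-loaded finite-cluster price R5, `FrustratedLawDichotomyTransportPriceFiniteForce`): a
counterexample to `Φaper` has NO vacant site with field below `2e⋆ − 1/12` (units `V_LJ(1) = −1/12`, `2e⋆ ≈ −1.43`): an empty,
well-coordinated cage (twelve atoms at distance `≈ 1` from a vacant centre plus second shells) is a deep hole, so minimising Nash laws
have none — a local clause the census can test on clusters next to force balance and Laplacian stability.  The by-name cut of the
crux by this clause is `FrustratedLawDichotomyVacancyCut`.  All `[folklore]` (global one-particle optimality + conditioning on a
re-rooting-invariant event; cf. Radin 1991, ground states as minimising invariant measures).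
-/

noncomputable section

namespace Summit.AtomisticToContinuum.Crystallization.Theorems.FrustratedLawDichotomyVacancyFloor

open MeasureTheory Metric Set Filter Topology TopologicalSpace
open scoped ENNReal BigOperators
open Literature.MathematicalPhysics.StatisticalMechanics Literature.Probability.Process
open Summit.AtomisticToContinuum.Crystallization.Theorems.ChargedEnergyGapNegative (E3 eStar)
open Summit.AtomisticToContinuum.Crystallization.Theorems.FrustratedLawDichotomyFiniteClusterGap
  (integrable_rootEnergy_of_ae_hardCore setOf_count_restrict_singleton_ne_zero)
open Summit.AtomisticToContinuum.Crystallization.Theorems.FrustratedLawDichotomyAperiodicGapFiniteCut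
  (isPointStationaryLaw_restrict_of_hc_invariant isProbabilityMeasure_cond')
open Summit.AtomisticToContinuum.Crystallization.Theorems.FrustratedLawDichotomyVacancyField

/-! ## §1. The deep-hole event -/

section Event

variable {δ : ℝ} {μ : Measure E3}

/-- The `ℝ≥0∞` parts of the field are Giry-measurable in the configuration. [folklore] -/
theorem measurable_lintegral_field (y : E3) :
    Measurable (fun ν : Measure E3 => ∫⁻ z, ENNReal.ofReal (lennardJones (dist y z)) ∂ν) ∧
      Measurable (fun ν : Measure E3 => ∫⁻ z, ENNReal.ofReal (-lennardJones (dist y z)) ∂ν) := by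
  have hV : Measurable lennardJones := by unfold lennardJones; fun_prop
  have hm : Measurable fun z : E3 => lennardJones (dist y z) := hV.comp (measurable_const.dist measurable_id)
  exact ⟨Measure.measurable_lintegral (ENNReal.measurable_ofReal.comp hm),
    Measure.measurable_lintegral (ENNReal.measurable_ofReal.comp hm.neg)⟩

/-- **The deep-hole event is Giry-measurable.** [folklore] -/
theorem measurableSet_holeEvent (c : ℝ) :
    MeasurableSet {ν : Measure E3 | ∃ n : ℕ, ν {denseSeq E3 n} = 0 ∧
      (∫⁻ z, ENNReal.ofReal (lennardJones (dist (denseSeq E3 n) z)) ∂ν).toReal -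
        (∫⁻ z, ENNReal.ofReal (-lennardJones (dist (denseSeq E3 n) z)) ∂ν).toReal < c} := by
  have h : {ν : Measure E3 | ∃ n : ℕ, ν {denseSeq E3 n} = 0 ∧
      (∫⁻ z, ENNReal.ofReal (lennardJones (dist (denseSeq E3 n) z)) ∂ν).toReal -
        (∫⁻ z, ENNReal.ofReal (-lennardJones (dist (denseSeq E3 n) z)) ∂ν).toReal < c} =
      ⋃ n : ℕ, ({ν : Measure E3 | ν {denseSeq E3 n} = 0} ∩ {ν : Measure E3 |
        (∫⁻ z, ENNReal.ofReal (lennardJones (dist (denseSeq E3 n) z)) ∂ν).toReal -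
          (∫⁻ z, ENNReal.ofReal (-lennardJones (dist (denseSeq E3 n) z)) ∂ν).toReal < c}) := by
    ext ν
    simp only [mem_setOf_eq, mem_iUnion, mem_inter_iff]
  rw [h]
  refine MeasurableSet.iUnion fun n => MeasurableSet.inter ?_ ?_
  · exact (Measure.measurable_coe (measurableSet_singleton _)) (measurableSet_singleton 0)
  · obtain ⟨hp, hn⟩ := measurable_lintegral_field (denseSeq E3 n)
    exact measurableSet_lt (hp.ennreal_toReal.sub hn.ennreal_toReal) measurable_const

/-- Covariance of the field parts under re-rooting: the field of `θ_p ν` at `y` is the field of `ν` at `y + p`. [folklore] -/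
theorem lintegral_field_map_sub (ν : Measure E3) (p y : E3) :
    ∫⁻ z, ENNReal.ofReal (lennardJones (dist y z)) ∂(Measure.map (fun z : E3 => z - p) ν) =
        ∫⁻ z, ENNReal.ofReal (lennardJones (dist (y + p) z)) ∂ν ∧
      ∫⁻ z, ENNReal.ofReal (-lennardJones (dist y z)) ∂(Measure.map (fun z : E3 => z - p) ν) =
        ∫⁻ z, ENNReal.ofReal (-lennardJones (dist (y + p) z)) ∂ν := by
  have hV : Measurable lennardJones := by unfold lennardJones; fun_prop
  have hm : Measurable fun z : E3 => lennardJones (dist y z) := hV.comp (measurable_const.dist measurable_id)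
  have hm2 : Measurable fun z : E3 => -lennardJones (dist y z) := hm.neg
  have hd : ∀ z : E3, dist y (z - p) = dist (y + p) z := fun z => by
    rw [dist_eq_norm, dist_eq_norm]; congr 1; abel
  constructor
  · rw [lintegral_map hm.ennreal_ofReal (measurable_sub_const p)]
    simp only [hd]
  · rw [lintegral_map hm2.ennreal_ofReal (measurable_sub_const p)]
    simp only [hd]

/-- Covariance of vacancy: `(θ_p ν) {y} = ν {y + p}`. [folklore] -/
theorem map_sub_apply_singleton (ν : Measure E3) (p y : E3) :
    Measure.map (fun z : E3 => z - p) ν {y} = ν {y + p} := by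
  rw [Measure.map_apply (measurable_sub_const p) (measurableSet_singleton y)]
  congr 1
  ext z
  simp only [mem_preimage, mem_singleton_iff, sub_eq_iff_eq_add]

/-- From a deep hole at an arbitrary vacant point to the countable event: if `ν` is a rooted `δ`-hard-core configuration with a vacant
`y` of field `< c`, then `ν ∈ K_c`. [folklore] -/
theorem mem_holeEvent_of_hole (hδ : 0 < δ) (hν : IsRootedHardCore δ μ) {y : E3} (hy : μ {y} = 0) {c : ℝ}
    (hc : (∫⁻ z, ENNReal.ofReal (lennardJones (dist y z)) ∂μ).toReal -
      (∫⁻ z, ENNReal.ofReal (-lennardJones (dist y z)) ∂μ).toReal < c) :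
    μ ∈ {ν : Measure E3 | ∃ n : ℕ, ν {denseSeq E3 n} = 0 ∧
      (∫⁻ z, ENNReal.ofReal (lennardJones (dist (denseSeq E3 n) z)) ∂ν).toReal -
        (∫⁻ z, ENNReal.ofReal (-lennardJones (dist (denseSeq E3 n) z)) ∂ν).toReal < c} := by
  obtain ⟨S, -, hsep, rfl⟩ := hν
  have hmem := count_restrict_singleton_ne_zero_iff (E := E3) S
  have hyS : y ∉ S := fun h => (hmem y).2 h hy
  obtain ⟨n, hnS, hlt⟩ := exists_denseSeq_hole hδ hsep hyS hc
  refine ⟨n, ?_, hlt⟩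
  by_contra h
  exact hnS ((hmem _).1 h)

/-- **The deep-hole event is invariant under re-rooting of rooted hard-core configurations.** [folklore] -/
theorem holeEvent_invariant (hδ : 0 < δ) (c : ℝ) (ν : Measure E3) (hν : IsRootedHardCore δ ν) (p : E3) (hp : ν {p} ≠ 0) :
    ν ∈ {ν : Measure E3 | ∃ n : ℕ, ν {denseSeq E3 n} = 0 ∧
      (∫⁻ z, ENNReal.ofReal (lennardJones (dist (denseSeq E3 n) z)) ∂ν).toReal -
        (∫⁻ z, ENNReal.ofReal (-lennardJones (dist (denseSeq E3 n) z)) ∂ν).toReal < c} ↔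
    Measure.map (fun z : E3 => z - p) ν ∈ {ν : Measure E3 | ∃ n : ℕ, ν {denseSeq E3 n} = 0 ∧
      (∫⁻ z, ENNReal.ofReal (lennardJones (dist (denseSeq E3 n) z)) ∂ν).toReal -
        (∫⁻ z, ENNReal.ofReal (-lennardJones (dist (denseSeq E3 n) z)) ∂ν).toReal < c} := by
  have hν' : IsRootedHardCore δ (Measure.map (fun z : E3 => z - p) ν) := hν.map_sub hp
  constructor
  · rintro ⟨n, hvac, hlt⟩
    -- the hole `d_n` of `ν` is the hole `d_n - p` of `θ_p ν`
    have hvac' : Measure.map (fun z : E3 => z - p) ν {denseSeq E3 n - p} = 0 := by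
      rw [map_sub_apply_singleton, sub_add_cancel, hvac]
    obtain ⟨h1, h2⟩ := lintegral_field_map_sub ν p (denseSeq E3 n - p)
    refine mem_holeEvent_of_hole hδ hν' hvac' ?_
    rw [h1, h2, sub_add_cancel]
    exact hlt
  · rintro ⟨n, hvac', hlt'⟩
    have hvac : ν {denseSeq E3 n + p} = 0 := by rw [← map_sub_apply_singleton, hvac']
    obtain ⟨h1, h2⟩ := lintegral_field_map_sub ν p (denseSeq E3 n)
    refine mem_holeEvent_of_hole hδ hν hvac ?_
    rw [← h1, ← h2]
    exact hlt'

end Event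

/-! ## §2. The vacancy floor -/

section Law

variable {δ : ℝ} {P : Measure (Measure E3)}

/-- **THE DEEP-HOLE EVENT IS NULL.**  Granted the energy floor of item 9229 (hypothesis `hU`), under clauses (a) (`δ > 0`), (b) and (e)
(verbatim) of the crux — NO minimality — `P {∃ n, d_n vacant ∧ Φ(d_n) < c} = 0` for every `c` with `c + 1/12 < 2e⋆`. [folklore] -/
theorem measure_holeEvent_eq_zero_of_nash
    (hU : ∀ δ' : ℝ, 0 < δ' → ∀ Q : Measure (Measure E3), IsProbabilityMeasure Q → (∀ᵐ μ ∂Q, IsRootedHardCore δ' μ) →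
      IsPointStationaryLaw Q → eStar ≤ ∫ μ, rootEnergy lennardJones μ ∂Q)
    (hδ : 0 < δ) [IsProbabilityMeasure P] (ha : ∀ᵐ μ ∂P, IsRootedHardCore δ μ) (hb : IsPointStationaryLaw P)
    (he : ∀ᵐ μ ∂P, ∀ p : E3, μ {p} ≠ 0 → ∀ y : E3, (∀ q : E3, μ {q} ≠ 0 → q ≠ p → y ≠ q) →
      ∑' q : {q : E3 // μ {q} ≠ 0 ∧ q ≠ p}, lennardJones (dist p (q : E3)) ≤
        ∑' q : {q : E3 // μ {q} ≠ 0 ∧ q ≠ p}, lennardJones (dist y (q : E3)))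
    {c : ℝ} (hc : c + 1 / 12 < 2 * eStar) :
    P {ν : Measure E3 | ∃ n : ℕ, ν {denseSeq E3 n} = 0 ∧
      (∫⁻ z, ENNReal.ofReal (lennardJones (dist (denseSeq E3 n) z)) ∂ν).toReal -
        (∫⁻ z, ENNReal.ofReal (-lennardJones (dist (denseSeq E3 n) z)) ∂ν).toReal < c} = 0 := by
  set K : Set (Measure E3) := {ν : Measure E3 | ∃ n : ℕ, ν {denseSeq E3 n} = 0 ∧
      (∫⁻ z, ENNReal.ofReal (lennardJones (dist (denseSeq E3 n) z)) ∂ν).toReal -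
        (∫⁻ z, ENNReal.ofReal (-lennardJones (dist (denseSeq E3 n) z)) ∂ν).toReal < c} with hK
  have hKm : MeasurableSet K := measurableSet_holeEvent c
  by_contra h0
  -- the conditioned law
  haveI : IsProbabilityMeasure ((P K)⁻¹ • P.restrict K) := isProbabilityMeasure_cond' h0
  have ha' : ∀ᵐ μ ∂((P K)⁻¹ • P.restrict K), IsRootedHardCore δ μ := Measure.ae_smul_measure (ae_restrict_of_ae ha) _
  have hb' : IsPointStationaryLaw ((P K)⁻¹ • P.restrict K) :=
    (isPointStationaryLaw_restrict_of_hc_invariant hδ ha hb hKm (fun μ hμ p hp => holeEvent_invariant hδ c μ hμ p hp)).smul _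
  have hK' : ∀ᵐ μ ∂((P K)⁻¹ • P.restrict K), μ ∈ K := Measure.ae_smul_measure (ae_restrict_mem hKm) _
  have he' := Measure.ae_smul_measure (ae_restrict_of_ae he (s := K)) (P K)⁻¹
  -- the floor for the conditioned law
  have hfloor := hU δ hδ _ inferInstance ha' hb'
  -- every configuration of `K` has root energy `≤ (c + 1/12)/2`
  have hbd : ∀ᵐ μ ∂((P K)⁻¹ • P.restrict K), rootEnergy lennardJones μ ≤ (c + 1 / 12) / 2 := by
    filter_upwards [ha', hK', he'] with μ hμ hμK hN
    obtain ⟨n, hvac, hlt⟩ := hμK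
    have h00 : μ {0} ≠ 0 := by rw [hμ.measure_zero_singleton]; exact one_ne_zero
    have h2 := two_mul_rootEnergy_le_field_of_nash hδ hμ (hN 0 h00) hvac
    linarith
  have hint : Integrable (fun μ : Measure E3 => rootEnergy lennardJones μ) ((P K)⁻¹ • P.restrict K) :=
    integrable_rootEnergy_of_ae_hardCore hδ ha'
  have hle := integral_mono_ae hint (integrable_const ((c + 1 / 12) / 2)) hbd
  rw [integral_const, smul_eq_mul, probReal_univ, one_mul] at hle
  linarith

/-- **THE VACANCY FLOOR («no deep holes»).**  Granted the energy floor of item 9229, under clauses (a), (b), (e) of the crux — no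
minimality — `P`-almost surely the Lennard-Jones field at every vacant point is at least `2e⋆ − 1/12`:
`∀ y, μ {y} = 0 → 2e⋆ − 1/12 ≤ (∫⁻ V_LJ(dist y ·)⁺ dμ).toReal − (∫⁻ V_LJ(dist y ·)⁻ dμ).toReal`. [folklore] -/
theorem ae_vacancyFloor_of_nash
    (hU : ∀ δ' : ℝ, 0 < δ' → ∀ Q : Measure (Measure E3), IsProbabilityMeasure Q → (∀ᵐ μ ∂Q, IsRootedHardCore δ' μ) →
      IsPointStationaryLaw Q → eStar ≤ ∫ μ, rootEnergy lennardJones μ ∂Q)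
    (hδ : 0 < δ) [IsProbabilityMeasure P] (ha : ∀ᵐ μ ∂P, IsRootedHardCore δ μ) (hb : IsPointStationaryLaw P)
    (he : ∀ᵐ μ ∂P, ∀ p : E3, μ {p} ≠ 0 → ∀ y : E3, (∀ q : E3, μ {q} ≠ 0 → q ≠ p → y ≠ q) →
      ∑' q : {q : E3 // μ {q} ≠ 0 ∧ q ≠ p}, lennardJones (dist p (q : E3)) ≤
        ∑' q : {q : E3 // μ {q} ≠ 0 ∧ q ≠ p}, lennardJones (dist y (q : E3))) :
    ∀ᵐ μ ∂P, ∀ y : E3, μ {y} = 0 →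
      2 * eStar - 1 / 12 ≤ (∫⁻ z, ENNReal.ofReal (lennardJones (dist y z)) ∂μ).toReal -
        (∫⁻ z, ENNReal.ofReal (-lennardJones (dist y z)) ∂μ).toReal := by
  have hae : ∀ᵐ μ ∂P, ∀ c : ℚ, (c : ℝ) + 1 / 12 < 2 * eStar →
      μ ∉ {ν : Measure E3 | ∃ n : ℕ, ν {denseSeq E3 n} = 0 ∧
        (∫⁻ z, ENNReal.ofReal (lennardJones (dist (denseSeq E3 n) z)) ∂ν).toReal -
          (∫⁻ z, ENNReal.ofReal (-lennardJones (dist (denseSeq E3 n) z)) ∂ν).toReal < c} := by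
    rw [ae_all_iff]
    intro c
    by_cases hc : (c : ℝ) + 1 / 12 < 2 * eStar
    · filter_upwards [compl_mem_ae_iff.2 (measure_holeEvent_eq_zero_of_nash hU hδ ha hb he hc)] with μ hμ _ using hμ
    · exact Eventually.of_forall fun μ h => absurd h hc
  filter_upwards [ha, hae] with μ hμ hK y hy
  by_contra hlt
  rw [not_le] at hlt
  obtain ⟨c, hc1, hc2⟩ := exists_rat_btwn hlt
  exact hK c (by linarith) (mem_holeEvent_of_hole hδ hμ hy hc1)

/-- **THE VACANCY FLOOR, series form.**  As `ae_vacancyFloor_of_nash`, with the field written as the series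
`Σ'_{q atom} V_LJ(dist y q)` over the atoms of `μ` (the crux's own vocabulary). [folklore] -/
theorem ae_vacancyFloor_tsum_of_nash
    (hU : ∀ δ' : ℝ, 0 < δ' → ∀ Q : Measure (Measure E3), IsProbabilityMeasure Q → (∀ᵐ μ ∂Q, IsRootedHardCore δ' μ) →
      IsPointStationaryLaw Q → eStar ≤ ∫ μ, rootEnergy lennardJones μ ∂Q)
    (hδ : 0 < δ) [IsProbabilityMeasure P] (ha : ∀ᵐ μ ∂P, IsRootedHardCore δ μ) (hb : IsPointStationaryLaw P)
    (he : ∀ᵐ μ ∂P, ∀ p : E3, μ {p} ≠ 0 → ∀ y : E3, (∀ q : E3, μ {q} ≠ 0 → q ≠ p → y ≠ q) →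
      ∑' q : {q : E3 // μ {q} ≠ 0 ∧ q ≠ p}, lennardJones (dist p (q : E3)) ≤
        ∑' q : {q : E3 // μ {q} ≠ 0 ∧ q ≠ p}, lennardJones (dist y (q : E3))) :
    ∀ᵐ μ ∂P, ∀ y : E3, μ {y} = 0 →
      2 * eStar - 1 / 12 ≤ ∑' q : {q : E3 // μ {q} ≠ 0}, lennardJones (dist y (q : E3)) := by
  filter_upwards [ha, ae_vacancyFloor_of_nash hU hδ ha hb he] with μ hμ hfl y hy
  have h := hfl y hy
  obtain ⟨S, h0, hsep, rfl⟩ := hμ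
  have hmem := count_restrict_singleton_ne_zero_iff (E := E3) S
  have hyS : y ∉ S := fun h' => (hmem y).2 h' hy
  obtain ⟨ρ, hρ, hfar⟩ := exists_pos_forall_le_dist hδ hsep hyS
  rw [← (tsum_lennardJones_dist_eq_parts hδ hsep hρ hfar).2.2] at h
  have h2 : ∑' q : {q : E3 // (Measure.count : Measure E3).restrict S {q} ≠ 0}, lennardJones (dist y (q : E3)) =
      ∑' q : S, lennardJones (dist y (q : E3)) :=
    tsum_congr_set_coe (fun q : E3 => lennardJones (dist y q)) (setOf_count_restrict_singleton_ne_zero S)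
  rw [h2]
  exact h

end Law

end Summit.AtomisticToContinuum.Crystallization.Theorems.FrustratedLawDichotomyVacancyFloor

end
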